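import Summits.NavierStokesRegularity.NavierStokesRegularity.Theorems.FilamentSkeletonRssDefectColumnGateVorticityAdjointCutoff
import Literature.Analysis.FluidPDE.RadialCalculus

/-!
# Route `FilamentSkeletonRss` · negative item `NoExactProfileNearSymmetricPair` (stmt-NavierStokesRegularity-24091) — S_γ groundwork (B2):
# the FREE ADJOINT COMMITTOR `Ψ₀(y) = ψ(y)·e₃`, `ψ(y) = ∫₀¹ e^{−t²|y|²/4} dt` — an exact, positive, global solution of the free rotating adjoint equation

Helper file (theorems only), `--supports stmt-NavierStokesRegularity-24091 --as helper`; LEAD of 23611 / registrar of 23920, lane ns-filament-21221-p1 g15.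

WHY.  Step (γ-1) of the B2′ design note (`Cruxes/TransverseReductionRJ/Lines/defect_column_gate_1AR_B2_gamma.md`) asks for an adjoint solution `Ψ` with CONTROLLED SIGN
STRUCTURE, built from the known drift.  The formal adjoint of the steady vorticity operator is
`𝒯_U^*Ψ = −α(e₃×Ψ − DΨ[e₃×y]) − ½Ψ − ½DΨ[y] − ΔΨ − DΨ[U] − (DU)†Ψ` (`vorticity_lagrange_identity`, p693934).  At `U = 0` (the far field of the window, where the
profile is small against the Leray drift `½y`) it has an EXPLICIT global kernel element for EVERY rotation rate `α`:
  `Ψ₀(y) = ψ(y) e₃`,  `ψ(y) = G(|y|²)`,  `G(u) = ∫₀¹ exp(−t²u/4) dt`  (`= |y|⁻¹∫₀^{|y|} e^{−s²/4} ds`, `ψ(0) = 1`, `0 < ψ ≤ 1`, `ψ ~ √π/|y|`):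
the rotation terms vanish because `e₃ × e₃ = 0` and `ψ` is radial, and the scalar equation `Δψ + ½y·∇ψ + ½ψ = 0` reduces, in the variable `u = |y|²`, to
`4uG″ + (6 + u)G′ + ½G = 0`, which holds because the integrand of `4uG″ + (6+u)G′ + ½G` is the exact `t`-derivative of `½t(1 − t²)e^{−t²u/4}` (vanishing at `t = 0, 1`).
CONSEQUENCES (not all here): `ψ > 0` is a ground state for the free scalar adjoint operator `Δ + (½y − αe₃×y)·∇ + ½`, so by the generalised minimum principle
(`generalized_min_principle`, brick (B3)) that operator has a comparison principle on domains of ANY size; and for a general `U` the residual of `Ψ₀` is exactly the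
`U`-coupling `−DΨ₀[U] − (DU)†Ψ₀` (`vorticityAdjoint_freeCommittor`), the perturbation a true (γ-1) committor must absorb.

Contents: `hasDerivAt_intervalIntegral_mul_gauss` (differentiation under `∫₀¹ p(t)e^{−t²u/4}dt`), `hasDerivAt_committorProfile`, `hasDerivAt_committorProfile_deriv`,
`committorProfile_ode` (`4uG″ + (6+u)G′ + ½G = 0`), `contDiff_two_committorProfile`, `contDiff_two_freeCommittor`, `freeCommittor_pos`, `freeCommittor_le_one`,
`freeCommittor_zero`, `norm_mul_freeCommittor_le` (`|y|ψ(y) ≤ √π`), `fderiv_freeCommittor_rot` (`Dψ[e₃×y] = 0`), `freeCommittor_pde` (`Δψ + ½Dψ[y] + ½ψ = 0`), `vorticityAdjoint_freeCommittor` (the vector statement).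
HONEST FRAMING: explicit special-function calculus on the NEGATIVE side of a HYPOTHETICAL filament-type rotating-self-similar blow-up route (MODEL rung); 24091/23611/23920
OPEN; nothing here bears on Navier–Stokes regularity, which is NOT proved.
-/

set_option linter.dupNamespace false

noncomputable section

namespace Summit.NavierStokesRegularity.NavierStokesRegularity.Theorems.DefectColumnGate

open scoped BigOperators Topology InnerProductSpace Laplacian ContDiff
open Set Function MeasureTheory intervalIntegral Real
open Literature.Analysis.FluidPDE
open Summit.NavierStokesRegularity.NavierStokesRegularity.Theorems.KelvinGate

/-! ## 1. The profile `G(u) = ∫₀¹ e^{−t²u/4} dt`: differentiation under the integral sign -/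

/-- **Differentiation under the integral sign** for `u ↦ ∫₀¹ p(t)·e^{−t²u/4} dt` (`p` continuous): the derivative at `u₀` is `∫₀¹ p(t)·(−t²/4)·e^{−t²u₀/4} dt`. -/
theorem hasDerivAt_intervalIntegral_mul_gauss {p : ℝ → ℝ} (hp : Continuous p) (u₀ : ℝ) :
    HasDerivAt (fun u => ∫ t in (0:ℝ)..1, p t * Real.exp (-(t ^ 2 * u / 4)))
      (∫ t in (0:ℝ)..1, p t * (-(t ^ 2 / 4) * Real.exp (-(t ^ 2 * u₀ / 4)))) u₀ := by
  obtain ⟨P, hP⟩ := isCompact_Icc.exists_bound_of_continuousOn (hp.continuousOn (s := Icc (0:ℝ) 1))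
  have hP0 : 0 ≤ P := (norm_nonneg _).trans (hP 0 ⟨le_rfl, zero_le_one⟩)
  have hcontF : ∀ u : ℝ, Continuous fun t : ℝ => p t * Real.exp (-(t ^ 2 * u / 4)) := fun u => by fun_prop
  have hcontF' : ∀ u : ℝ, Continuous fun t : ℝ => p t * (-(t ^ 2 / 4) * Real.exp (-(t ^ 2 * u / 4))) := fun u => by fun_prop
  have key := intervalIntegral.hasDerivAt_integral_of_dominated_loc_of_deriv_le
    (F := fun u t => p t * Real.exp (-(t ^ 2 * u / 4)))
    (F' := fun u t => p t * (-(t ^ 2 / 4) * Real.exp (-(t ^ 2 * u / 4))))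
    (x₀ := u₀) (s := Metric.ball u₀ 1) (bound := fun _ => P * Real.exp (|u₀| + 1)) (μ := volume) (a := 0) (b := 1)
    (Metric.ball_mem_nhds u₀ one_pos)
    (Filter.Eventually.of_forall fun u => (hcontF u).aestronglyMeasurable)
    ((hcontF u₀).intervalIntegrable 0 1)
    ((hcontF' u₀).aestronglyMeasurable)
    ?_ intervalIntegrable_const ?_
  · exact key.2
  · -- the uniform bound on `Ι 0 1 × ball u₀ 1`
    refine Filter.Eventually.of_forall fun t ht u hu => ?_
    rw [Set.uIoc_of_le zero_le_one] at ht
    have ht0 : 0 ≤ t := ht.1.le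
    have ht1 : t ≤ 1 := ht.2
    have hpt : |p t| ≤ P := by have := hP t ⟨ht0, ht1⟩; rwa [Real.norm_eq_abs] at this
    have hu' : |u| ≤ |u₀| + 1 := by
      have : dist u u₀ < 1 := hu
      rw [Real.dist_eq] at this
      have := abs_sub_abs_le_abs_sub u u₀
      linarith
    have ht2 : t ^ 2 ≤ 1 := by nlinarith
    have hexp : Real.exp (-(t ^ 2 * u / 4)) ≤ Real.exp (|u₀| + 1) := by
      apply Real.exp_le_exp.mpr
      have h1 : -(t ^ 2 * u / 4) ≤ t ^ 2 * |u| / 4 := by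
        have := neg_abs_le u
        nlinarith [sq_nonneg t]
      have h2 : t ^ 2 * |u| / 4 ≤ |u| := by nlinarith [abs_nonneg u]
      linarith
    have hq : |(-(t ^ 2 / 4))| ≤ 1 := by rw [abs_neg, abs_of_nonneg (by positivity)]; linarith
    calc ‖p t * (-(t ^ 2 / 4) * Real.exp (-(t ^ 2 * u / 4)))‖
        = |p t| * (|(-(t ^ 2 / 4))| * Real.exp (-(t ^ 2 * u / 4))) := by
          rw [Real.norm_eq_abs, abs_mul, abs_mul, abs_of_pos (Real.exp_pos _)]
      _ ≤ P * (1 * Real.exp (|u₀| + 1)) := by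
          apply mul_le_mul hpt _ (by positivity) hP0
          exact mul_le_mul hq hexp (Real.exp_pos _).le zero_le_one
      _ = P * Real.exp (|u₀| + 1) := by ring
  · -- pointwise differentiability in the parameter
    refine Filter.Eventually.of_forall fun t _ u _ => ?_
    have h1 : HasDerivAt (fun u : ℝ => -(t ^ 2 * u / 4)) (-(t ^ 2 / 4)) u := by
      have := (((hasDerivAt_id u).const_mul (t ^ 2)).div_const 4).fun_neg
      exact this.congr_deriv (by simp)
    have h2 := (h1.exp).const_mul (p t)
    exact h2.congr_deriv (by ring)

/-- `G′(u) = ∫₀¹ (−t²/4) e^{−t²u/4} dt`. -/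
theorem hasDerivAt_committorProfile (u : ℝ) :
    HasDerivAt (fun u => ∫ t in (0:ℝ)..1, Real.exp (-(t ^ 2 * u / 4)))
      (∫ t in (0:ℝ)..1, -(t ^ 2 / 4) * Real.exp (-(t ^ 2 * u / 4))) u := by
  have h := hasDerivAt_intervalIntegral_mul_gauss (p := fun _ => (1:ℝ)) continuous_const u
  have e1 : (fun u : ℝ => ∫ t in (0:ℝ)..1, (fun _ => (1:ℝ)) t * Real.exp (-(t ^ 2 * u / 4))) = fun u => ∫ t in (0:ℝ)..1, Real.exp (-(t ^ 2 * u / 4)) := by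
    funext v; exact intervalIntegral.integral_congr fun t _ => by simp
  have e2 : (∫ t in (0:ℝ)..1, (fun _ => (1:ℝ)) t * (-(t ^ 2 / 4) * Real.exp (-(t ^ 2 * u / 4)))) = ∫ t in (0:ℝ)..1, -(t ^ 2 / 4) * Real.exp (-(t ^ 2 * u / 4)) :=
    intervalIntegral.integral_congr fun t _ => by simp
  rw [e1, e2] at h
  exact h

/-- `G″(u) = ∫₀¹ (t⁴/16) e^{−t²u/4} dt`. -/
theorem hasDerivAt_committorProfile_deriv (u : ℝ) :
    HasDerivAt (fun u => ∫ t in (0:ℝ)..1, -(t ^ 2 / 4) * Real.exp (-(t ^ 2 * u / 4)))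
      (∫ t in (0:ℝ)..1, t ^ 4 / 16 * Real.exp (-(t ^ 2 * u / 4))) u := by
  have h := hasDerivAt_intervalIntegral_mul_gauss (p := fun t => -(t ^ 2 / 4)) (by fun_prop) u
  refine h.congr_deriv (intervalIntegral.integral_congr fun t _ => ?_)
  ring

/-- `G‴`-level: `u ↦ ∫₀¹ (t⁴/16) e^{−t²u/4} dt` is differentiable (hence continuous). -/
theorem hasDerivAt_committorProfile_deriv_deriv (u : ℝ) :
    HasDerivAt (fun u => ∫ t in (0:ℝ)..1, t ^ 4 / 16 * Real.exp (-(t ^ 2 * u / 4)))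
      (∫ t in (0:ℝ)..1, t ^ 4 / 16 * (-(t ^ 2 / 4) * Real.exp (-(t ^ 2 * u / 4)))) u :=
  hasDerivAt_intervalIntegral_mul_gauss (p := fun t => t ^ 4 / 16) (by fun_prop) u

/-- **The ODE of the profile**: `4u·G″(u) + (6 + u)·G′(u) + ½·G(u) = 0` for every real `u` — the integrand is the exact derivative of `½t(1−t²)e^{−t²u/4}`, which
vanishes at `t = 0` and `t = 1`. -/
theorem committorProfile_ode (u : ℝ) :
    4 * u * (∫ t in (0:ℝ)..1, t ^ 4 / 16 * Real.exp (-(t ^ 2 * u / 4)))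
      + (6 + u) * (∫ t in (0:ℝ)..1, -(t ^ 2 / 4) * Real.exp (-(t ^ 2 * u / 4)))
      + (1/2:ℝ) * (∫ t in (0:ℝ)..1, Real.exp (-(t ^ 2 * u / 4))) = 0 := by
  have hc2 : Continuous fun t : ℝ => t ^ 4 / 16 * Real.exp (-(t ^ 2 * u / 4)) := by fun_prop
  have hc1 : Continuous fun t : ℝ => -(t ^ 2 / 4) * Real.exp (-(t ^ 2 * u / 4)) := by fun_prop
  have hc0 : Continuous fun t : ℝ => Real.exp (-(t ^ 2 * u / 4)) := by fun_prop
  -- collect into one integral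
  rw [← intervalIntegral.integral_const_mul, ← intervalIntegral.integral_const_mul, ← intervalIntegral.integral_const_mul,
    ← intervalIntegral.integral_add (by exact (Continuous.intervalIntegrable (by fun_prop) 0 1)) (by exact (Continuous.intervalIntegrable (by fun_prop) 0 1)),
    ← intervalIntegral.integral_add (by exact (Continuous.intervalIntegrable (by fun_prop) 0 1)) (by exact (Continuous.intervalIntegrable (by fun_prop) 0 1))]
  -- the primitive `F(t) = ½ t (1 − t²) e^{−t²u/4}`
  have hF : ∀ t ∈ Set.uIcc (0:ℝ) 1, HasDerivAt (fun t : ℝ => (1/2:ℝ) * t * (1 - t ^ 2) * Real.exp (-(t ^ 2 * u / 4)))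
      (4 * u * (t ^ 4 / 16 * Real.exp (-(t ^ 2 * u / 4))) + (6 + u) * (-(t ^ 2 / 4) * Real.exp (-(t ^ 2 * u / 4)))
        + (1/2:ℝ) * Real.exp (-(t ^ 2 * u / 4))) t := by
    intro t _
    have h1 : HasDerivAt (fun t : ℝ => -(t ^ 2 * u / 4)) (-(2 * t * u / 4)) t := by
      have := (((hasDerivAt_pow 2 t).mul_const u).div_const 4).fun_neg
      exact this.congr_deriv (by norm_num)
    have ha : HasDerivAt (fun t : ℝ => (1/2:ℝ) * t) ((1/2:ℝ) * 1) t := (hasDerivAt_id t).const_mul (1/2:ℝ)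
    have hb : HasDerivAt (fun t : ℝ => 1 - t ^ 2) (-(2 * t)) t := ((hasDerivAt_pow 2 t).const_sub 1).congr_deriv (by norm_num)
    have h3 := (ha.fun_mul hb).fun_mul h1.exp
    exact h3.congr_deriv (by ring)
  rw [intervalIntegral.integral_eq_sub_of_hasDerivAt hF ((Continuous.intervalIntegrable (by fun_prop) 0 1))]
  norm_num

/-- **`G ∈ C²(ℝ)`**: `u ↦ ∫₀¹ e^{−t²u/4} dt` is twice continuously differentiable on `ℝ`. -/
theorem contDiff_two_committorProfile : ContDiff ℝ 2 (fun u : ℝ => ∫ t in (0:ℝ)..1, Real.exp (-(t ^ 2 * u / 4))) := by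
  have hd0 : deriv (fun u : ℝ => ∫ t in (0:ℝ)..1, Real.exp (-(t ^ 2 * u / 4))) = fun u => ∫ t in (0:ℝ)..1, -(t ^ 2 / 4) * Real.exp (-(t ^ 2 * u / 4)) :=
    funext fun u => (hasDerivAt_committorProfile u).deriv
  have hd1 : deriv (fun u : ℝ => ∫ t in (0:ℝ)..1, -(t ^ 2 / 4) * Real.exp (-(t ^ 2 * u / 4))) = fun u => ∫ t in (0:ℝ)..1, t ^ 4 / 16 * Real.exp (-(t ^ 2 * u / 4)) :=
    funext fun u => (hasDerivAt_committorProfile_deriv u).deriv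
  have h2c : Continuous (fun u : ℝ => ∫ t in (0:ℝ)..1, t ^ 4 / 16 * Real.exp (-(t ^ 2 * u / 4))) :=
    continuous_iff_continuousAt.mpr fun u => (hasDerivAt_committorProfile_deriv_deriv u).continuousAt
  have h1 : ContDiff ℝ 1 (fun u : ℝ => ∫ t in (0:ℝ)..1, -(t ^ 2 / 4) * Real.exp (-(t ^ 2 * u / 4))) := by
    rw [show (1 : WithTop ℕ∞) = 0 + 1 from (zero_add 1).symm, contDiff_succ_iff_deriv]
    refine ⟨fun u => (hasDerivAt_committorProfile_deriv u).differentiableAt, by simp, ?_⟩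
    rw [hd1]; exact contDiff_zero.mpr h2c
  rw [show (2 : WithTop ℕ∞) = 1 + 1 from (one_add_one_eq_two).symm, contDiff_succ_iff_deriv]
  refine ⟨fun u => (hasDerivAt_committorProfile u).differentiableAt, by simp, ?_⟩
  rw [hd0]; exact h1

/-! ## 2. The free committor `ψ(y) = G(|y|²)` on `ℝ³` -/

/-- **`ψ ∈ C²(ℝ³)`**. -/
theorem contDiff_two_freeCommittor :
    ContDiff ℝ 2 (fun y : EuclideanSpace ℝ (Fin 3) => ∫ t in (0:ℝ)..1, Real.exp (-(t ^ 2 * ‖y‖ ^ 2 / 4))) :=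
  contDiff_two_committorProfile.comp (contDiff_norm_sq ℝ)

/-- `ψ(0) = 1`. -/
theorem freeCommittor_zero : (∫ t in (0:ℝ)..1, Real.exp (-(t ^ 2 * ‖(0 : EuclideanSpace ℝ (Fin 3))‖ ^ 2 / 4))) = 1 := by
  simp

/-- `0 < ψ(y)`. -/
theorem freeCommittor_pos (y : EuclideanSpace ℝ (Fin 3)) : 0 < ∫ t in (0:ℝ)..1, Real.exp (-(t ^ 2 * ‖y‖ ^ 2 / 4)) :=
  intervalIntegral.intervalIntegral_pos_of_pos_on ((Continuous.intervalIntegrable (by fun_prop) 0 1)) (fun t _ => Real.exp_pos _) zero_lt_one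

/-- `ψ(y) ≤ 1`. -/
theorem freeCommittor_le_one (y : EuclideanSpace ℝ (Fin 3)) : (∫ t in (0:ℝ)..1, Real.exp (-(t ^ 2 * ‖y‖ ^ 2 / 4))) ≤ 1 := by
  have h : (∫ t in (0:ℝ)..1, Real.exp (-(t ^ 2 * ‖y‖ ^ 2 / 4))) ≤ ∫ _ in (0:ℝ)..1, (1:ℝ) := by
    refine intervalIntegral.integral_mono_on zero_le_one ((Continuous.intervalIntegrable (by fun_prop) 0 1)) intervalIntegrable_const
      fun t _ => ?_
    rw [Real.exp_le_one_iff]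
    have : 0 ≤ t ^ 2 * ‖y‖ ^ 2 / 4 := by positivity
    linarith
  simpa using h

/-- **Decay `ψ(y) ≤ √π/|y|`**: `|y|·ψ(y) ≤ √π` (substitute `s = t|y|/2`: `ψ(y) = (2/|y|)∫₀^{|y|/2} e^{−s²} ds ≤ (2/|y|)·(√π/2)`).  So the committor's tail is the
scaling-critical `|y|⁻¹` (the homogeneous adjoint mode `|y|⁻¹e₃`), NOT Gaussian. -/
theorem norm_mul_freeCommittor_le (y : EuclideanSpace ℝ (Fin 3)) :
    ‖y‖ * (∫ t in (0:ℝ)..1, Real.exp (-(t ^ 2 * ‖y‖ ^ 2 / 4))) ≤ Real.sqrt Real.pi := by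
  rcases eq_or_ne y 0 with hy | hy
  · rw [hy, norm_zero, zero_mul]; positivity
  have hr : 0 < ‖y‖ := norm_pos_iff.mpr hy
  set r : ℝ := ‖y‖ with hr_def
  -- substitution `s = t · (r/2)`
  have hc : r / 2 ≠ 0 := by positivity
  have hsub : (∫ t in (0:ℝ)..1, Real.exp (-(t ^ 2 * r ^ 2 / 4))) = (r / 2)⁻¹ * ∫ s in (0:ℝ)..(r / 2), Real.exp (-(1:ℝ) * s ^ 2) := by
    have h := intervalIntegral.integral_comp_mul_right (fun s : ℝ => Real.exp (-(1:ℝ) * s ^ 2)) hc (a := 0) (b := 1)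
    simp only [zero_mul, one_mul, smul_eq_mul] at h
    rw [← h]
    congr 1; funext t; congr 1; ring
  -- Gaussian tail bound `∫₀^{r/2} e^{−s²} ≤ ∫₀^∞ e^{−s²} = √π/2`
  have hgauss : (∫ s in (0:ℝ)..(r / 2), Real.exp (-(1:ℝ) * s ^ 2)) ≤ Real.sqrt Real.pi / 2 := by
    rw [intervalIntegral.integral_of_le (by positivity : (0:ℝ) ≤ r / 2)]
    have hI : IntegrableOn (fun s : ℝ => Real.exp (-(1:ℝ) * s ^ 2)) (Ioi 0) := (integrable_exp_neg_mul_sq one_pos).integrableOn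
    calc (∫ s in Ioc 0 (r / 2), Real.exp (-(1:ℝ) * s ^ 2))
        ≤ ∫ s in Ioi 0, Real.exp (-(1:ℝ) * s ^ 2) :=
          setIntegral_mono_set hI (Filter.Eventually.of_forall fun s => (Real.exp_pos _).le) (Filter.Eventually.of_forall Ioc_subset_Ioi_self)
      _ = Real.sqrt Real.pi / 2 := by rw [integral_gaussian_Ioi, div_one]
  rw [hsub]
  have : r * ((r / 2)⁻¹ * ∫ s in (0:ℝ)..(r / 2), Real.exp (-(1:ℝ) * s ^ 2)) = 2 * ∫ s in (0:ℝ)..(r / 2), Real.exp (-(1:ℝ) * s ^ 2) := by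
    field_simp
  rw [this]
  linarith

/-- **The committor is blind to the rotation**: `Dψ(y)[e₃ × y] = 0` (ψ is radial and `y ⊥ e₃ × y`). -/
theorem fderiv_freeCommittor_rot (y : EuclideanSpace ℝ (Fin 3)) :
    fderiv ℝ (fun z : EuclideanSpace ℝ (Fin 3) => ∫ t in (0:ℝ)..1, Real.exp (-(t ^ 2 * ‖z‖ ^ 2 / 4))) y (cross (EuclideanSpace.single 2 1) y) = 0 := by
  have h := fderiv_comp_norm_sq_apply (g := fun u : ℝ => ∫ t in (0:ℝ)..1, Real.exp (-(t ^ 2 * u / 4))) (hasDerivAt_committorProfile (‖y‖ ^ 2))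
    (cross (EuclideanSpace.single 2 1) y)
  have h0 : ⟪y, cross (EuclideanSpace.single 2 1) y⟫_ℝ = 0 := by
    rw [cross_single_two_eq_rotGenL, rotGenL_apply, real_inner_comm, inner_rotGen_self]
  simp only [h0, mul_zero] at h
  convert h using 3

/-- **THE FREE ADJOINT EQUATION, scalar form**: `Δψ(y) + ½·Dψ(y)[y] + ½·ψ(y) = 0` at every `y ∈ ℝ³`. -/
theorem freeCommittor_pde (y : EuclideanSpace ℝ (Fin 3)) :
    (Δ (fun z : EuclideanSpace ℝ (Fin 3) => ∫ t in (0:ℝ)..1, Real.exp (-(t ^ 2 * ‖z‖ ^ 2 / 4)))) y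
      + (1/2:ℝ) * fderiv ℝ (fun z : EuclideanSpace ℝ (Fin 3) => ∫ t in (0:ℝ)..1, Real.exp (-(t ^ 2 * ‖z‖ ^ 2 / 4))) y y
      + (1/2:ℝ) * (∫ t in (0:ℝ)..1, Real.exp (-(t ^ 2 * ‖y‖ ^ 2 / 4))) = 0 := by
  -- rewrite `ψ` as `G ∘ ‖·‖²`
  have hfun : (fun z : EuclideanSpace ℝ (Fin 3) => ∫ t in (0:ℝ)..1, Real.exp (-(t ^ 2 * ‖z‖ ^ 2 / 4)))
      = fun z => (fun u : ℝ => ∫ t in (0:ℝ)..1, Real.exp (-(t ^ 2 * u / 4))) (‖z‖ ^ 2) := rfl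
  rw [hfun]
  have hL := laplacian_comp_norm_sq (E := EuclideanSpace ℝ (Fin 3)) (g := fun u : ℝ => ∫ t in (0:ℝ)..1, Real.exp (-(t ^ 2 * u / 4)))
    (g₁ := fun u : ℝ => ∫ t in (0:ℝ)..1, -(t ^ 2 / 4) * Real.exp (-(t ^ 2 * u / 4))) (U := Set.univ) isOpen_univ
    (fun σ _ => hasDerivAt_committorProfile σ) (Set.mem_univ (‖y‖ ^ 2)) (hasDerivAt_committorProfile_deriv (‖y‖ ^ 2))
  have hD := fderiv_comp_norm_sq_apply (g := fun u : ℝ => ∫ t in (0:ℝ)..1, Real.exp (-(t ^ 2 * u / 4))) (hasDerivAt_committorProfile (‖y‖ ^ 2)) y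
  rw [hL, hD, real_inner_self_eq_norm_sq, finrank_euclideanSpace, Fintype.card_fin]
  have hode := committorProfile_ode (‖y‖ ^ 2)
  have e : (fun t : ℝ => Real.exp (-(t ^ 2 * (‖y‖ ^ 2) / 4))) = fun t => Real.exp (-(t ^ 2 * ‖y‖ ^ 2 / 4)) := rfl
  push_cast
  linarith

/-! ## 3. The vector statement: `Ψ₀ = ψ·e₃` solves the free rotating adjoint equation; its residual at a general `U` -/

/-- **`Ψ₀ = ψ e₃ ∈ C²`**. -/
theorem contDiff_two_freeCommittor_smul_e3 :
    ContDiff ℝ 2 (fun y : EuclideanSpace ℝ (Fin 3) => (∫ t in (0:ℝ)..1, Real.exp (-(t ^ 2 * ‖y‖ ^ 2 / 4))) • (EuclideanSpace.single 2 (1:ℝ) : EuclideanSpace ℝ (Fin 3))) :=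
  contDiff_two_freeCommittor.smul contDiff_const

/-- **THE FREE ADJOINT COMMITTOR.**  For EVERY rotation rate `α` and EVERY field `U`, at every `y`, the field `Ψ₀(y) = ψ(y)·e₃` (hypothesis `hΨ₀`) satisfies
`𝒯_U^*Ψ₀(y) = −DΨ₀(y)[U(y)] − (DU(y))†Ψ₀(y)`: the free part of the adjoint operator (rotation + Leray drift + Laplacian) annihilates `Ψ₀` EXACTLY, and the residual is the
bare `U`-coupling.  In particular `𝒯_0^*Ψ₀ = 0` on all of `ℝ³` (`vorticityAdjoint_freeCommittor_zero`: `−α(e₃×Ψ₀ − DΨ₀[e₃×y]) − ½Ψ₀ − ½DΨ₀[y] − ΔΨ₀ = 0`). -/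
theorem vorticityAdjoint_freeCommittor (α : ℝ) (U : EuclideanSpace ℝ (Fin 3) → EuclideanSpace ℝ (Fin 3)) {Ψ₀ : EuclideanSpace ℝ (Fin 3) → EuclideanSpace ℝ (Fin 3)}
    (hΨ₀ : Ψ₀ = fun z => (∫ t in (0:ℝ)..1, Real.exp (-(t ^ 2 * ‖z‖ ^ 2 / 4))) • (EuclideanSpace.single 2 (1:ℝ) : EuclideanSpace ℝ (Fin 3)))
    (y : EuclideanSpace ℝ (Fin 3)) :
    -(α • (cross (EuclideanSpace.single 2 1) (Ψ₀ y) - fderiv ℝ Ψ₀ y (cross (EuclideanSpace.single 2 1) y))) - (1/2:ℝ) • Ψ₀ y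
        - (1/2:ℝ) • fderiv ℝ Ψ₀ y y - (Δ Ψ₀) y - fderiv ℝ Ψ₀ y (U y) - ContinuousLinearMap.adjoint (fderiv ℝ U y) (Ψ₀ y)
      = -(fderiv ℝ Ψ₀ y (U y)) - ContinuousLinearMap.adjoint (fderiv ℝ U y) (Ψ₀ y) := by
  set ψ : EuclideanSpace ℝ (Fin 3) → ℝ := fun z => ∫ t in (0:ℝ)..1, Real.exp (-(t ^ 2 * ‖z‖ ^ 2 / 4)) with hψ_def
  have hψ : ContDiff ℝ 2 ψ := contDiff_two_freeCommittor
  have hψd : ∀ z, DifferentiableAt ℝ ψ z := fun z => hψ.differentiable (by norm_num) z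
  have hΨ : Ψ₀ = fun z => ψ z • (EuclideanSpace.single 2 (1:ℝ) : EuclideanSpace ℝ (Fin 3)) := hΨ₀
  -- derivative and Laplacian of `ψ • e₃`
  have hD : ∀ h, fderiv ℝ Ψ₀ y h = (fderiv ℝ ψ y h) • (EuclideanSpace.single 2 (1:ℝ) : EuclideanSpace ℝ (Fin 3)) := fun h => by
    rw [hΨ, ((hψd y).hasFDerivAt.smul_const (EuclideanSpace.single 2 (1:ℝ) : EuclideanSpace ℝ (Fin 3))).fderiv,
      ContinuousLinearMap.smulRight_apply]
  have hL : (Δ Ψ₀) y = ((Δ ψ) y) • (EuclideanSpace.single 2 (1:ℝ) : EuclideanSpace ℝ (Fin 3)) := by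
    rw [hΨ, laplacian_smul_field hψ contDiff_const y, laplacian_const_eq_zero, fderiv_fun_const]
    simp
  -- the rotation terms vanish
  have hrot1 : cross (EuclideanSpace.single 2 1) (Ψ₀ y) = 0 := by
    rw [cross_single_two_eq_rotGenL, hΨ]
    simp only [map_smul, rotGenL_apply, rotGen_single_two, smul_zero]
  have hrot2 : fderiv ℝ ψ y (cross (EuclideanSpace.single 2 1) y) = 0 := fderiv_freeCommittor_rot y
  -- the scalar equation
  have hpde : (Δ ψ) y + (1/2:ℝ) * fderiv ℝ ψ y y + (1/2:ℝ) * ψ y = 0 := freeCommittor_pde y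
  have hΨy : Ψ₀ y = ψ y • (EuclideanSpace.single 2 (1:ℝ) : EuclideanSpace ℝ (Fin 3)) := by rw [hΨ]
  rw [hD, hD, hD, hL, hrot1, hrot2, hΨy]
  have hΔ : (Δ ψ) y = -((1/2:ℝ) * fderiv ℝ ψ y y) - (1/2:ℝ) * ψ y := by linarith
  rw [hΔ]
  module

/-- **`𝒯_0^*Ψ₀ = 0`**: the free committor is an exact GLOBAL solution of the free rotating adjoint equation `−α(e₃×Ψ − DΨ[e₃×y]) − ½Ψ − ½DΨ[y] − ΔΨ = 0`, for every `α`. -/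
theorem vorticityAdjoint_freeCommittor_zero (α : ℝ) {Ψ₀ : EuclideanSpace ℝ (Fin 3) → EuclideanSpace ℝ (Fin 3)}
    (hΨ₀ : Ψ₀ = fun z => (∫ t in (0:ℝ)..1, Real.exp (-(t ^ 2 * ‖z‖ ^ 2 / 4))) • (EuclideanSpace.single 2 (1:ℝ) : EuclideanSpace ℝ (Fin 3)))
    (y : EuclideanSpace ℝ (Fin 3)) :
    -(α • (cross (EuclideanSpace.single 2 1) (Ψ₀ y) - fderiv ℝ Ψ₀ y (cross (EuclideanSpace.single 2 1) y))) - (1/2:ℝ) • Ψ₀ y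
        - (1/2:ℝ) • fderiv ℝ Ψ₀ y y - (Δ Ψ₀) y = 0 := by
  have h := vorticityAdjoint_freeCommittor α (0 : EuclideanSpace ℝ (Fin 3) → EuclideanSpace ℝ (Fin 3)) hΨ₀ y
  simpa using h

end Summit.NavierStokesRegularity.NavierStokesRegularity.Theorems.DefectColumnGate

end
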